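import Literature.AlgebraicGeometry.Milne1999.HodgeCMImpliesTateFiniteFields
import HarnessLib

/-!
# Milne 2002, Theorem 3.3: the Hodge conjecture for complex abelian varieties of CM-type implies,
# over every algebraically closed field, `hom_ℓ = num` and the Hodge standard conjecture for
# abelian varieties (ℓ-adic étale cohomology, `ℓ ≠ char`)

J. S. Milne, *Polarizations and Grothendieck's standard conjectures*, Ann. of Math. **155** (2002)
599–610 [Milne2002Polarizations]; text read: arXiv:math/0103175v3 (= the Annals version), printed
pages. Companion of `Literature/AlgebraicGeometry/Milne1999/HodgeCMImpliesTateFiniteFields.lean`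
(Milne 1999 Thm. 7.1, the input "(Milne 1999b, 7.1)" of the proof of Thm. 3.3 (a)); the hypothesis is
the SAME predicate `Milne1999.CMHodgeHypothesisAt` (Milne 2002, p. 601, restates the p. 72 / p. 54
conventions of Milne 1999 word for word). Statement-level typing only; the proof (Thm. 2.1: the
reduction functor carries the canonical polarization `Π^CM` to `Π^Mot`; Zink's CM lifting; a
specialization argument) is not formalised.

## The source, verbatim

* p. 601 (Notation): "By the Hodge conjecture for a variety `V` over `ℂ`, we mean the statement that,
  for all `r`, the `ℚ`-space `H^{2r}(V, ℚ) ∩ H^{r,r}` is spanned by the classes of algebraic cycles.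
  […] An abelian variety `A` over `ℂ` (or `ℚ^al`) is said to be of CM-type if, for each simple
  isogeny factor `B` of `A`, `End(B)_ℚ` is a commutative field of degree `2 dim B` over `ℚ`."
* p. 600: "the Hodge standard conjecture (Grothendieck 1969, §4), states that, for `r ≤ n/2`, the
  bilinear form `(x, y) ↦ (−1)^r ⟨L^{n−2r} x · y⟩ : P^r(V) × P^r(V) → ℚ` is positive-definite. Here
  `P^r(V)` is the `ℚ`-space of primitive algebraic classes of codimension `r` modulo homological
  equivalence."
* p. 607: "Theorem 3.3. Let `k` be an algebraically closed field. If the Hodge conjecture holds for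
  complex abelian varieties of CM-type, then, for all `ℓ ≠ char(k)`, (a) numerical equivalence
  coincides with ℓ-adic étale homological equivalence on abelian varieties over `k`, and (b) the
  Hodge standard conjecture holds for all abelian varieties over `k` and the ℓ-adic étale cohomology
  theory."  Proof of (a), `k = 𝔽`: "The Hodge conjecture for complex abelian varieties of CM-type
  implies the Tate conjecture (Milne 1999b, 7.1), which implies (a) (see, for example, Tate 1994,
  2.7)."  pp. 607–608, arbitrary `k`: "The specialization maps on the cohomology groups are
  bijective and hence they are injective on the `P`'s. Since the pairings are compatible, this
  implies the Hodge standard conjecture for `A` and ℓ-adic étale cohomology. Because the Lefschetz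
  standard conjecture is known for abelian varieties, this in turn implies that numerical
  equivalence coincides with ℓ-adic homological equivalence for `A` (Kleiman 1994, 5-4)."
* p. 608: "Corollary 3.4. If the Hodge conjecture holds for complex abelian varieties of CM-type,
  then, for any algebraically closed field `k`, `Mot(k; A)` has a polarization (necessarily unique)
  for which the forms `ϑ_r` and `φ_r` are positive."; Remark 3.5 (same hypothesis: Hdg holds for a
  Weil cohomology `H` on abelian varieties over `k` iff `H` is good); Remark 3.6 (reflex-field
  restricted version); Remarks 3.7–3.8 (the Lefschetz-class analogue of Hdg holds UNCONDITIONALLY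
  for abelian varieties; hence Hdg for abelian varieties with no exotic algebraic classes); Remark
  3.9 ("Should the Hodge conjecture remain inaccessible, even for abelian varieties of CM-type,
  Theorem 3.3 suggests a possible approach […] improve the theory of absolute Hodge classes").
* NOT covered by Thm. 3.3 (abstract, p. 599): Hdg "for all smooth projective varieties if in
  addition the Tate conjecture holds for smooth projective varieties over finite fields" — a further
  hypothesis; not rendered.

## Lean rendering

* ℓ-adic étale cohomology of varieties over the algebraically closed field `k` (`[IsAlgClosed k]`,
  any characteristic; `ℓ` prime with `[NeZero (ℓ : k)]`, i.e. `ℓ ≠ char k`) with `ℚ_ℓ`-coefficients is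
  the explicit binder `W : Motives.WeilCohomology k ℚ_[ℓ]` (the tree's hypothesis structure; no Galois
  action is needed over an algebraically closed field), exactly as the tree's standard-conjecture
  statements `W.HomNumStandardConjecture`, `W.HodgeStandardConjecture` (`Motives/Correspondences`).
* (a) for an abelian variety `A/k` is the tree's per-variety `D(A)`: `W.StandardConjectureD A.dim A.X`
  (homological-for-`W` and numerical equivalence agree on `ℚ`-cycles; Milne's "numerical equivalence
  coincides with ℓ-adic étale homological equivalence on abelian varieties over `k`", the `ℤ`/`ℚ`
  passage being elementary as in Milne 1999 p. 75).
  (b) is the tree's per-`(A, η)` `Hdg(A)`: `W.StandardConjectureHdg A.dim A.X η` for every hyperplane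
  class `η` (`W.IsHyperplaneClass A.X η`), i.e. positivity of `(−1)^r⟨L^{n−2r}x · x⟩` on primitive
  rational algebraic classes — Kleiman's `Hdg(X)`, the form quoted from p. 600.
* Thm. 3.3 is `Theorem33 ℓ W : Prop := (∀ A : AbelianVariety ℂ, Milne1999.CMHodgeHypothesisAt A) →
  ∀ A : AbelianVariety k, D(A) ∧ ∀ η hyperplane, Hdg(A, η)` — a `W`-parametrised cited PREDICATE
  (Milne's theorem at the intended `W` = ℓ-adic étale cohomology of `k`-varieties; not asserted for
  arbitrary Weil cohomology data, for which Hdg can fail — cf. Remark 3.5 "if `H` is not good, then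
  the Hodge standard conjecture fails for `H`"), in the standing of `Milne1999.Theorem71` and
  `Motives.TateImpliesHodgeAbelianStatement`. No `_holds` is owed or claimed.
* Edges by name: `hodgeStandard_abelianVariety_of_HC_CM`, `standardConjectureD_abelianVariety_of_HC_CM`.

## Status of the source: the author's addendum page and the erratum to Milne 1999b §6 (read 2026-08-19)

Recorded so that a reader of the record `Theorem33` sees the complete printed standing of Thm. 3.3;
nothing below changes a Lean statement of this file.
* The author's addenda page for this paper [Milne2002aAddendum] (`jmilne.org/math/articles/2002a.html`,
  HTTP last-modified 2019-10-06) is headed "Addendum": "Yves André has requested that I explain in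
  more detail the statement in the proof of Theorem 2.1 'It follows from Milne 1999b that `S^K/P^K`
  acts faithfully on `X = End(h₁A)^P`'", followed by a proof ("With the notations of Milne 1999b,
  Section 6 (especially p22,23 of the pdf file on my site) […] As `P^K/L^K ↪ T^{A^Ψ×A^Ψ̄}/L^{A^Π×A^Π̄}`
  (cf. ibid. Lemma 6.9), this implies the statement.") and the footnote "In the Bibliography of his
  article JIMJ 5 (2006), 605-627, André refers to an 'erratum' for this paper. Presumably he means
  this addendum: there is no erratum."
* The proof of Thm. 2.1 (p. 604; the input of Thm. 3.3 (b)) fixes "a CM-field `K ⊂ ℚ^al` such that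
  (a) `K` is finite and Galois over `ℚ`, and (b) `K` properly contains an imaginary quadratic field in
  which `p` splits", says "It suffices to prove (∗) for `R_K`", and uses "(ibid. §6) the canonical map
  `S^K/P^K → T^K/L^K` is injective" — the per-`K` form of Milne 1999b Thm. 6.1 (`P^K = L^K ∩ S^K`).
  The author's ERRATUM page for Milne 1999b [Milne1999bErratum] (last-modified 2022-07-29; quoted in
  `Milne1999/HodgeCMImpliesTateFiniteFields`, "Status of the source") records, from S. de Vries, that
  the assumptions of that per-`K` step "are not enough. There are counterexamples when `K = ℚ(i, √n)`
  for suitable choices of `n` (depending on `p`)", with the fix "It suffices to add the condition that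
  `K` contains a degree `> 2` real subfield in which `p` is inert."  Since (∗) is needed for a
  cofinal family of `K` only (the classes `𝒞_K`, `𝒜_K` exhaust `𝒞`, `𝒜`), restricting to the `K`
  that satisfy the corrected condition repairs the proof of Thm. 2.1 and leaves the STATEMENTS of
  Thm. 2.1 and Thm. 3.3 as printed; Thm. 3.3 (a) rests on Milne 1999b Thm. 7.1, whose standing is
  recorded in the companion file (limit statement, unaffected; independently re-proved in
  [deVries2021TateAVFiniteFields] under the corrected hypothesis). What the erratum DOES affect here is
  the per-`K` Remark 3.6 (p. 608): "Let `K` be a CM-subfield of `ℚ^al` satisfying conditions (a) and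
  (b) of the proof of (2.1). […] if the Hodge conjecture holds for all complex abelian varieties with
  reflex field contained in `K`, then the conclusions of Theorem 3.3 hold for all abelian varieties
  over `𝔽` whose endomorphism algebra is split by `K`. In fact, condition (b) is not necessary for
  this statement because, as Deligne pointed out to me, the results of Milne 1999b, §6, hold without
  it." — established only for `K` satisfying the corrected largeness condition; for other `K` (e.g.
  the quartic fields named in the erratum) the per-`K` statement rests solely on Milne,
  arXiv:2112.12815v2 App. 5.4 (unrefereed, 2022-02, its Case II `ι ∉ D` "left as an exercise"), the
  erratum itself bearing demonstrably on the 1999b proof's intermediate claims (Lemma 6.7) — see the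
  companion file's "Status of the source". Remark 3.6 is NOT typed in this file (only cited), so no
  Lean statement depends on it.

## Minimal form of the hypothesis, and an alternative hypothesis: the author's 2020 note (read 2026-08-20)

Recorded for the same purpose (the complete printed standing of Thm. 3.3); nothing below changes a
Lean statement of this file.
* [Milne2020LefschetzStandardFiniteFields] (arXiv:2011.06563 v1 of 2020-11-12, 13 pp.; a preprint —
  no journal version is recorded by arXiv or Crossref as of 2026-08-20), §3, verbatim: "**Theorem 3.3.**
  Assume that the Lefschetz standard conjecture holds for algebraic varieties over `𝔽` and `ℓ`-adic
  étale cohomology (some `ℓ ≠ p`). Then Grothendieck's standard conjecture of Hodge type holds for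
  abelian varieties over fields of characteristic `p` and the classical Weil cohomology theories.
  PROOF. In [milne2002p] the Hodge standard conjecture for abelian varieties in characteristic `p` is
  shown to follow from the Hodge conjecture for CM abelian varieties over `ℂ`. Again, the proof uses
  only that the Hodge classes become algebraic modulo `p`, and so the theorem follows from Proposition
  (g43)." — (g43) being Thm. 2.6 there: "Assume that the Lefschetz standard conjecture holds for
  algebraic varieties over `𝔽`. Let `A` be an abelian variety over `ℚ^al` with good reduction at `w` to
  an abelian variety `A₀` over `𝔽`, and let `t` be an absolute Hodge class on `A`. The class `(t_ℓ)₀`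
  on `A₀` is algebraic." (`𝔽` = an algebraic closure of `𝔽_p`, `w | p` a prime of `ℚ^al`, §2.2–2.3);
  and §1, Plain 1.3: an *almost-algebraic class* is "an absolute Hodge class `γ` of codimension `r`
  such that there exists a cartesian square [`𝒳 → S ∋ Spec(k)`, `f : 𝒳 → S`] and a global section `γ̃`
  of `R^{2r}f_*𝔸(r)` satisfying the following conditions, • `S` is the spectrum of a regular integral
  domain of finite type over `ℤ`; • `f` is smooth and projective; • the fibre of `γ̃` over `Spec(k)` is
  `γ`, and the reduction of `γ̃` at `s` is algebraic for all closed points `s` in a dense open subset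
  of `S`."  Introduction, Thm. 2: "The Lefschetz standard conjecture for algebraic varieties over `𝔽`
  implies • the full Tate conjecture for abelian varieties over `𝔽`; • the standard conjecture of Hodge
  type for abelian varieties in characteristic `p`."
* BEARING ON THM. 3.3 AS TYPED HERE. (i) By the author's own later account, the hypothesis CONSUMED by
  the printed proof of Thm. 3.3 is weaker than (H): it is that Hodge classes on CM abelian varieties
  over `ℚ^al` (with good reduction at the chosen `w`) become algebraic modulo `p` — a statement implied
  by (H), since an algebraic cycle on `A` specializes, with its cohomology class, to an algebraic cycle
  on `A₀` (Fulton, *Intersection Theory*, §20.3; SGA 4½ [Cycle]). So `Theorem33 ℓ W`, whose hypothesis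
  is (H) exactly as printed in 2002, carries a hypothesis STRONGER than the proof needs, never weaker;
  nothing is over-claimed by the record. (ii) The same conclusions (a), (b) also follow in print from a
  hypothesis INDEPENDENT of (H) — Grothendieck's Lefschetz standard conjecture `B` for all varieties
  over `𝔽̄_p` and ℓ-adic cohomology (Thm. 3.3 of the note) — so a failure of (H) would not by itself
  refute (a) or (b). Neither hypothesis is a theorem. This file types the (H)-form only: (H) is the
  hypothesis printed in the refereed source and the one the tree's consumers hold
  (`RankFourFaces.CMAbelianHodge`); the 2020 weakening is a remark inside a proof of an unrefereed note
  and is recorded here, not typed (no new predicate, no new record).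
* AN EARLIER, PUBLISHED LOCUS OF THE SAME ACCOUNT (read 2026-08-20):
  [Milne2016RiemannHypothesisFiniteFields] = J. S. Milne, *The Riemann hypothesis over finite fields:
  from Weil to the present day*, Notices of the ICCM **4** (2016) no. 2, 14–52 (= arXiv:1509.00797),
  §3, verbatim: "E 3.21. The Hodge conjecture implies the standard conjecture of Lefschetz type over
  `ℂ` (obviously). Conversely, the standard conjecture of Lefschetz type over `ℂ` implies the Hodge
  conjecture for abelian varieties (Abdulali 1994, André 1996), and hence the standard conjecture of
  Hodge type for abelian varieties in all characteristics (Milne 2002)."; "E 3.22. Tate's conjecture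
  implies the standard conjecture of Lefschetz type (obviously). If the full Tate conjecture is true
  over finite fields of characteristic `p`, then the standard conjecture of Hodge type holds in
  characteristic `p`."; and the sketch following it: "Let `k` denote an algebraic closure of `𝔽_p`.
  The author showed that the Hodge conjecture for CM abelian varieties over `ℂ` implies the standard
  conjecture of Hodge type for abelian varieties over `k`. The proof uses only that Hodge classes on
  CM abelian varieties are almost-algebraic at `p` (see ((r90)) below for this notion). The Tate
  conjecture for finite subfields of `k` implies the standard conjecture of Lefschetz type over `k`
  (obviously), and, using ideas of Abdulali and André, one can deduce that Hodge classes on CM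
  abelian varieties are almost-algebraic at `p`; therefore the standard conjecture of Hodge type
  holds for abelian varieties over `k`. The full Tate conjecture implies that the category of motives
  over `k` is generated by the motives of abelian varieties, and so the Hodge standard conjecture
  holds for all nonsingular projective varieties over `k`. A specialization argument now proves it
  for all varieties in characteristic `p`." — with «almost-algebraic at `p`» defined in Plain 4.5
  there (the cartesian square `𝒱 → S ∋ Spec k` of Plain 1.3 above, "cf. Tate 1994, p.76", followed
  by: "If the above data can be chosen so that `(p)` is in the image of the natural map
  `U → Spec ℤ`, then we say that `γ` is almost-algebraic at `p` — in particular, this means that `V`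
  has good reduction at `p`.") and "By the full Tate conjecture, I mean the Tate conjecture plus
  `num = hom(ℓ)` (cf. Tate 1994, 2.9)" (before E 3.21). So item (i) of the preceding bullet — the
  proof of Thm. 3.3 consumes only almost-algebraicity at `p` of Hodge classes on CM abelian
  varieties — is the author's PUBLISHED statement of 2016, four years before the 2020 note; the
  (H)-independent route of item (ii) appears there with the hypothesis "full Tate conjecture over
  finite fields of characteristic `p`" in place of the note's Lefschetz standard conjecture over `𝔽`.
  Nothing typed changes.

## References

* [Milne2002Polarizations] Ann. of Math. 155 (2002): Notation p. 601; Thm. 2.1 p. 604; Thm. 3.3,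
  Cor. 3.4, Rem. 3.5–3.9 pp. 607–608.
* [Milne2002aAddendum] J. S. Milne, addenda page `https://www.jmilne.org/math/articles/2002a.html`
  (last-modified 2019-10-06): Addendum (faithfulness of `S^K/P^K` on `End(h₁A)^P`; "there is no
  erratum").
* [Milne1999bErratum] J. S. Milne, addenda page `https://www.jmilne.org/math/articles/1999b.html`
  (last-modified 2022-07-29): Erratum to "Completion of the proof of the Theorem 6.1" (S. de Vries),
  with the fix; [deVries2021TateAVFiniteFields] S. W. de Vries, Master's thesis, Bonn 2021, §4.4.1.
* [Milne1999] Compositio Math. 117 (1999), Thm. 7.1 (the input of 3.3 (a)).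
* [Milne2020LefschetzStandardFiniteFields] J. S. Milne, Grothendieck's standard conjecture of Lefschetz
  type over finite fields, arXiv:2011.06563 v1 (2020): Introduction Thm. 2; §1 Plain 1.3; §2.3
  Thm. 2.6; §3 Thm. 3.3 with its proof.
* [Milne2016RiemannHypothesisFiniteFields] J. S. Milne, The Riemann hypothesis over finite fields:
  from Weil to the present day, Notices of the ICCM 4 (2016) no. 2, 14–52 (arXiv:1509.00797): §3,
  E 3.21, E 3.22 and the sketch following E 3.22; §4.2.2 Plain 4.5 (almost-algebraic classes,
  almost-algebraic at `p`).
* [Kleiman1968] S. Kleiman, Algebraic cycles and the Weil conjectures, §3 (`D(X)`, `Hdg(X)`) — the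
  tree's renderings in `Motives/Correspondences`.
-/

noncomputable section

open CategoryTheory

namespace Literature.AlgebraicGeometry.Milne2002

open Literature.AlgebraicGeometry.Motives
open Literature.AlgebraicGeometry.Milne1999

universe u

/-- **Milne 2002, Theorem 3.3** (p. 607, quoted verbatim in the module docstring) — a THEOREM in print:
for `k` algebraically closed and `ℓ ≠ char k`, hypothesis (H) of Milne 1999 Thm. 7.1 at every complex
abelian variety (`Milne1999.CMHodgeHypothesisAt`) implies, for every abelian variety `A` over `k`,
(a) the tree's `D(A)` for `W` (homological = numerical equivalence on `ℚ`-cycles) and (b) the tree's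
`Hdg(A, η)` for `W` and every hyperplane class `η` (positivity of `(−1)^r⟨L^{n−2r}x·x⟩` on primitive
rational algebraic classes, p. 600). READING NOTE on the quantifier over `η` (referee A of the
Hodge-CM cell, round 54 (3)(ii)): the display defining `Hdg(V)` on p. 600 is written for one (unnamed)
ample class `L`, while the sentence of Thm. 3.3 (b) — "holds for all abelian varieties over `k` and the
ℓ-adic étale cohomology theory" — fixes no `L`; (b) is therefore typed for EVERY hyperplane class `η`
(`∀ η, W.IsHyperplaneClass A.X η → …`), which SPECIALISES to any fixed `η` and adds nothing beyond the
printed sentence read with its own definition. A `W`-parametrised cited PREDICATE: Milne's theorem at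
the intended `W` = ℓ-adic étale cohomology of `k`-varieties, not asserted for arbitrary Weil
cohomology data (standing of `Milne1999.Theorem71`); proof in print (Thm. 2.1, Zink 1983 2.7,
specialization), not formalised. [cite: Milne2002Polarizations, Thm. 3.3 p. 607 and §1 p. 600 (definition of Hdg(V))] -/
def Theorem33 {k : Type u} [Field k] [IsAlgClosed k] (ℓ : ℕ) [Fact ℓ.Prime] [NeZero (ℓ : k)]
    (W : WeilCohomology k ℚ_[ℓ]) : Prop :=
  (∀ A : AbelianVariety ℂ, CMHodgeHypothesisAt A) →
    ∀ A : AbelianVariety k,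
      W.StandardConjectureD A.dim A.X ∧
        ∀ η : W.obj A.X 2, W.IsHyperplaneClass A.X η → W.StandardConjectureHdg A.dim A.X η

/-- **Edge (b): HC_CM ⟹ the Hodge standard conjecture `Hdg(A, η)` for every abelian variety over
every algebraically closed field and ℓ-adic étale cohomology, `ℓ ≠ char k`** (Milne 2002 Thm. 3.3 (b)),
by name: modus ponens on `Theorem33`. [cite: Milne2002Polarizations, Thm. 3.3 (b) p. 607] -/
theorem hodgeStandard_abelianVariety_of_HC_CM {k : Type u} [Field k] [IsAlgClosed k] {ℓ : ℕ}
    [Fact ℓ.Prime] [NeZero (ℓ : k)] {W : WeilCohomology k ℚ_[ℓ]} (h33 : Theorem33 ℓ W)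
    (hHC : ∀ A : AbelianVariety ℂ, CMHodgeHypothesisAt A) (A : AbelianVariety k)
    (η : W.obj A.X 2) (hη : W.IsHyperplaneClass A.X η) : W.StandardConjectureHdg A.dim A.X η :=
  (h33 hHC A).2 η hη

/-- **Edge (a): HC_CM ⟹ numerical = ℓ-adic homological equivalence (`D(A)`) for every abelian
variety over every algebraically closed field, `ℓ ≠ char k`** (Milne 2002 Thm. 3.3 (a)), by name.
[cite: Milne2002Polarizations, Thm. 3.3 (a) p. 607] -/
theorem standardConjectureD_abelianVariety_of_HC_CM {k : Type u} [Field k] [IsAlgClosed k]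
    {ℓ : ℕ} [Fact ℓ.Prime] [NeZero (ℓ : k)] {W : WeilCohomology k ℚ_[ℓ]} (h33 : Theorem33 ℓ W)
    (hHC : ∀ A : AbelianVariety ℂ, CMHodgeHypothesisAt A) (A : AbelianVariety k) :
    W.StandardConjectureD A.dim A.X :=
  (h33 hHC A).1

/-- Milne 2002 and Milne 1999 consume the SAME hypothesis: given both theorems at the intended data
(`W` over an algebraically closed `k`, and the finite-field family `E`), HC_CM yields Tate's (0.1)
over finite fields together with `D` and `Hdg` for abelian varieties over `k` (Thm. 3.3's proof of
(a) for `k = 𝔽` goes through Thm. 7.1, p. 607). [cite: Milne2002Polarizations, proof of Thm. 3.3 (a) p. 607] -/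
theorem tate_and_hodgeStandard_of_HC_CM {k : Type u} [Field k] [IsAlgClosed k] {ℓ : ℕ}
    [Fact ℓ.Prime] [NeZero (ℓ : k)] {W : WeilCohomology k ℚ_[ℓ]}
    {E : ∀ (k' : Type) [Field k'] [Finite k'] (ℓ' : ℕ) [Fact ℓ'.Prime] [NeZero (ℓ' : k')],
      GaloisWeilCohomology k' ℚ_[ℓ'] (padicCyclotomicCharacter k' ℓ')}
    (h71 : Theorem71 E) (h33 : Theorem33 ℓ W)
    (hHC : ∀ A : AbelianVariety ℂ, CMHodgeHypothesisAt A) :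
    TateStatement01 E ∧ ∀ A : AbelianVariety k, W.StandardConjectureD A.dim A.X ∧
      ∀ η : W.obj A.X 2, W.IsHyperplaneClass A.X η → W.StandardConjectureHdg A.dim A.X η :=
  ⟨tateAV_Fq_of_HC_CM h71 hHC, h33 hHC⟩

end Literature.AlgebraicGeometry.Milne2002

end
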